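/-
Copyright (c) 2026 the pub-hodgecm-mathlib formalisation cell (harness21).  Prover seat hodgecm-mathlib-K2Liu-p06 (g2): Track B «K2-LIT»,
#184♮ = hLiu418 = stmt-HodgeConjecture-24832; organ O33.5a for socket #33s `sig_K2LiuZetaSNonvanishingData` of the tier-1 socket module
`Cruxes/HLiu418/Lines/K2_Liu_CurveThetaSigs_U5d_ZetaS.lean` (ED. 3, sha16 7c2f436314d56d7b, :426; LEAD F0P6-plan (g10) RE-DEAL 2026-09-04T02:26:33Z); 2026-09-04.
-/
import Literature.NumberTheory.Automorphic.CompactGroupKFiniteVectorsPeterWeyl      -- ★ `IsTranslationFinite`, `dense_translationFiniteSubalgebra`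
import Literature.NumberTheory.K2Lit.SiegelStandardSections                          -- ★ `IwasawaDatum`, `IsKFinite`, `rightTranslateSpan`
import Literature.NumberTheory.K2Lit.SiegelEisensteinSeriesDoubled                   -- ★ `IsSiegelDeltaSection`
import Mathlib.MeasureTheory.Group.Integral
import Mathlib.Topology.ContinuousMap.Compact
import HarnessLib

/-!
# Crux `HLiu418`, Track B road `K2_Liu`, unit U5d «`Z_S`», socket #33s — organ O33.5a:
# the compact-group SMEAR of a function on a topological group along a continuous homomorphism `a : 𝕂 → Γ`
# (`(ρ_η φ)(h) = ∫_𝕂 η(k) φ(h·a(k)) dk`): equivariance, continuity, finiteness of translates, and uniform approximation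

Cell `hodgecm-mathlib`, crux item hLiu418 = `stmt-HodgeConjecture-24832`, route of record `HCCMUnconditional`; squad K2 ∕ K2Liu,
LEAD F0P6-plan (g10), planner K2Liu-plan (g2), prover K2Liu-p06 (g2).  THEOREMS ONLY (no `def`, no instance, no notation, no
named-fact hypothesis, no `sorry`, default heartbeats); lane `--supports stmt-HodgeConjecture-24832` (count-neutral helper).  The smear is
written out as the Bochner integral `fun h => ∫ k, η k * φ (h * a k) ∂ν` everywhere (no definition is introduced).

WHAT IS PROVED.  `Γ` a topological group, `𝕂` a COMPACT Hausdorff topological group with a left-invariant measure `ν` finite on compacts,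
`a : 𝕂 →* Γ` continuous, `φ : Γ → ℂ` continuous, `η : C(𝕂, ℂ)`.
* §1 `integrable_mul_comp_smear`, `smear_mul_left_of_forall` — left equivariance `φ(p h) = c φ(h) ∀ h` passes to the smear (sections stay sections:
  `isSiegelDeltaSection_smear` in the doubled-unitary frame);
* §2 `smear_apply_mul_eq` — **right translates of the smear are smears by left translates of the weight**:
  `(ρ_η φ)(h·a(k₀)) = (ρ_{λ(k₀)η} φ)(h)` (★ `leftTranslate k₀ η = η(k₀⁻¹ ·)`, left invariance of `ν`);
* §3 `continuous_integral_apply`, `continuous_smear` — the smear of a continuous `φ` is continuous (curry into `C(𝕂, ℂ)` + bounded functional);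
* §4 `exists_submodule_forall_smear_translate_mem` — **finiteness of translates**: if `η` is left-translation finite (★ `IsTranslationFinite`) and
  every `t` in a set `T ⊆ Γ` factors as `t = a(k₀)·u` with `u` commuting with `a(𝕂)` and `φ(· u)` ranging in a finite family of continuous
  functions, then all `h ↦ (ρ_η φ)(h t)`, `t ∈ T`, lie in ONE finite-dimensional subspace — `isKFinite_smear` reads it as ★ `IsKFinite 𝒦 (ρ_η φ)`
  for an Iwasawa datum whose `K` so factors;
* §5 `exists_nhds_forall_norm_sub_lt` — uniform continuity: on a compact `A ⊆ Γ`, `‖φ(h·a(k)) − φ(h)‖ < ε` for `k` near `1`, all `h ∈ A`;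
  `norm_smear_sub_le_of_forall` — for a weight `η ≥ 0` of mass `1` supported where that bound holds, `‖(ρ_η φ)(h) − φ(h)‖ ≤ ε` on `A`;
  `norm_smear_sub_smear_le` — `‖ρ_η φ(h) − ρ_{η'} φ(h)‖ ≤ δ · ν(𝕂) · M` when `‖η − η'‖ ≤ δ` pointwise and `‖φ(h·a k)‖ ≤ M`;
* §6 `exists_continuous_nonneg_integral_eq_one`, `exists_isTranslationFinite_forall_norm_sub_lt` — bumps of mass `1` supported in a given
  neighbourhood of `1`, and their uniform approximation by translation-finite weights (★ Peter–Weyl `dense_translationFiniteSubalgebra`).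
This is the generic half of step (2)∕O33.5 of the #33s road (tree docstring of `sig_K2LiuZetaSNonvanishingData`): «`K`-finite vectors are DENSE in the
Banach space of continuous sections» is used in the constructive form «the `K_∞`-finite smear `ρ_η φ♭` of a continuous section `φ♭` is a
`𝒦`-finite continuous section uniformly close to `φ♭` on compacts».

HONEST LABEL.  Count-neutral scaffold file of the K2_Liu road; it pays nothing by itself: `HC_CM` is proved only modulo the 7 printed citations
(2 remaining named inputs: hLiu418 = `stmt-HodgeConjecture-24832`, h413 = `stmt-HodgeConjecture-24833`) until rung 0 closes.

## References
* [BrockerTomDieck1985] T. Bröcker, T. tom Dieck, *Representations of Compact Lie Groups* (1985): III §1, (5.6)–(5.7) (representative functions, smearing).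
* [BorelJacquet1979] A. Borel, H. Jacquet, PSPM 33.1 (1979): §4.1 (`K`-finiteness = `K_∞`-finite ⊗ smooth).
* [Folland1995] G. B. Folland, *A Course in Abstract Harmonic Analysis* (1995): §2.2, §3.2.
* [Liu2011] Y. Liu, Algebra Number Theory 5 (2011): §2C (2-5) pp. 863–864.
-/

set_option autoImplicit false
set_option linter.dupNamespace false

noncomputable section

open scoped Topology
open MeasureTheory Filter

namespace Summit.HodgeConjecture.HodgeConjecture.Cruxes.HLiu418.K2LiuSectionSmear

open Literature.NumberTheory.Automorphic

section Generic

variable {Γ : Type*} [Group Γ] [TopologicalSpace Γ] [IsTopologicalGroup Γ]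
  {𝕂 : Type*} [Group 𝕂] [TopologicalSpace 𝕂] [IsTopologicalGroup 𝕂] [CompactSpace 𝕂] [T2Space 𝕂]
  [MeasurableSpace 𝕂] [BorelSpace 𝕂] (ν : Measure 𝕂) [IsFiniteMeasureOnCompacts ν]
  (a : 𝕂 →* Γ) (ha : Continuous a)

/-! ### §1 Integrability and left equivariance -/

omit [IsTopologicalGroup 𝕂] [T2Space 𝕂] in
include ha in
/-- The smear integrand `k ↦ η(k) φ(h·a(k))` is integrable (continuous on the compact group). [cite: Folland1995, §3.2] -/
theorem integrable_mul_comp_smear {φ : Γ → ℂ} (hφ : Continuous φ) (η : C(𝕂, ℂ)) (h : Γ) :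
    Integrable (fun k => η k * φ (h * a k)) ν :=
  ((η.continuous.mul (hφ.comp (continuous_const.mul ha))).integrable_of_hasCompactSupport
    (HasCompactSupport.of_compactSpace _))

omit [IsTopologicalGroup Γ] [TopologicalSpace Γ] [IsTopologicalGroup 𝕂] [CompactSpace 𝕂] [T2Space 𝕂] [BorelSpace 𝕂]
  [IsFiniteMeasureOnCompacts ν] [TopologicalSpace 𝕂] in
/-- **Left equivariance passes to the smear**: if `φ(p h) = c φ(h)` for all `h`, then `(ρ_η φ)(p h) = c (ρ_η φ)(h)`. [cite: Folland1995, §3.2] -/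
theorem smear_mul_left_of_forall (φ : Γ → ℂ) (η : 𝕂 → ℂ) {p : Γ} {c : ℂ} (hφ : ∀ h, φ (p * h) = c * φ h) (h : Γ) :
    (∫ k, η k * φ (p * h * a k) ∂ν) = c * ∫ k, η k * φ (h * a k) ∂ν := by
  rw [← integral_const_mul]
  refine integral_congr_ae (Eventually.of_forall fun k => ?_)
  change η k * φ (p * h * a k) = c * (η k * φ (h * a k))
  rw [mul_assoc p h, hφ, mul_left_comm]

/-! ### §2 Right translates of the smear -/

omit [IsTopologicalGroup Γ] [TopologicalSpace Γ] [CompactSpace 𝕂] [T2Space 𝕂] [IsFiniteMeasureOnCompacts ν] in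
/-- **`(ρ_η φ)(h·a(k₀)) = (ρ_{λ(k₀) η} φ)(h)`** (substitute `k ↦ k₀⁻¹ k`, left invariance of `ν`; ★ `leftTranslate_apply`). [cite: BrockerTomDieck1985, III (5.6)] -/
theorem smear_apply_mul_eq [ν.IsMulLeftInvariant] (φ : Γ → ℂ) (η : C(𝕂, ℂ)) (h : Γ) (k₀ : 𝕂) :
    (∫ k, η k * φ (h * a k₀ * a k) ∂ν) = ∫ k, leftTranslate k₀ η k * φ (h * a k) ∂ν := by
  have h1 : (fun k => leftTranslate k₀ η k * φ (h * a k)) =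
      fun k => (fun k' => η k' * φ (h * a k₀ * a k')) (k₀⁻¹ * k) := by
    funext k
    simp only [leftTranslate_apply, map_mul, map_inv, mul_assoc, mul_inv_cancel_left]
  rw [h1, integral_mul_left_eq_self (μ := ν) (fun k' => η k' * φ (h * a k₀ * a k')) k₀⁻¹]

/-! ### §3 Continuity -/

omit [Group 𝕂] [IsTopologicalGroup 𝕂] [T2Space 𝕂] in
/-- `g ↦ ∫ g dν` is continuous on `C(𝕂, ℂ)` (a bounded linear functional of norm `≤ ν(𝕂)`). [cite: Folland1995, §3.2] -/
theorem continuous_integral_apply : Continuous fun g : C(𝕂, ℂ) => ∫ k, g k ∂ν := by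
  have hint : ∀ g : C(𝕂, ℂ), Integrable (fun k => g k) ν := fun g =>
    g.continuous.integrable_of_hasCompactSupport (HasCompactSupport.of_compactSpace _)
  let I : C(𝕂, ℂ) →ₗ[ℂ] ℂ :=
    { toFun := fun g => ∫ k, g k ∂ν
      map_add' := fun g g' => by simpa using integral_add (hint g) (hint g')
      map_smul' := fun c g => by simpa using integral_smul c (fun k => g k) }
  refine AddMonoidHomClass.continuous_of_bound I (ν.real Set.univ) fun g => ?_
  rw [mul_comm]
  exact norm_integral_le_of_norm_le_const (Eventually.of_forall fun k => g.norm_coe_le_norm k)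

omit [IsTopologicalGroup 𝕂] [T2Space 𝕂] in
include ha in
/-- **The smear of a continuous function is continuous** (`h ↦ (k ↦ η(k) φ(h·a(k))) ∈ C(𝕂, ℂ)` is continuous by currying, then integrate).
[cite: Folland1995, §3.2] -/
theorem continuous_smear {φ : Γ → ℂ} (hφ : Continuous φ) (η : C(𝕂, ℂ)) :
    Continuous fun h : Γ => ∫ k, η k * φ (h * a k) ∂ν := by
  let F : C(Γ × 𝕂, ℂ) := ⟨fun q => η q.2 * φ (q.1 * a q.2),
    (η.continuous.comp continuous_snd).mul (hφ.comp (continuous_fst.mul (ha.comp continuous_snd)))⟩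
  have hc : Continuous fun h : Γ => F.curry h := F.curry.continuous
  exact (continuous_integral_apply ν).comp hc

/-! ### §4 Finiteness of translates -/

omit [T2Space 𝕂] in
include ha in
/-- **Finiteness of translates of a smear.** Let `η` be left-translation finite (★ `IsTranslationFinite`), `φ` continuous, and `T ⊆ Γ` a set each
of whose elements factors as `t = a(k₀)·u` with `u` commuting with `a(𝕂)` and `φ(· u)` one of finitely many continuous functions `φᵢ`.  Then
the functions `h ↦ (ρ_η φ)(h t)`, `t ∈ T`, all lie in one finite-dimensional subspace (spanned by the `ρ_{η'} φᵢ`, `η'` in the span of the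
translates of `η`). [cite: BrockerTomDieck1985, III (5.6)–(5.7)] [cite: BorelJacquet1979, §4.1] -/
theorem exists_submodule_forall_smear_translate_mem [ν.IsMulLeftInvariant] (φ : Γ → ℂ) {η : C(𝕂, ℂ)}
    (hη : IsTranslationFinite η) {ι : Type*} [Finite ι] (φfam : ι → Γ → ℂ) (hφfam : ∀ i, Continuous (φfam i))
    (T : Set Γ) (hT : ∀ t ∈ T, ∃ (k₀ : 𝕂) (u : Γ) (i : ι), t = a k₀ * u ∧ (∀ k, u * a k = a k * u) ∧ (fun h => φ (h * u)) = φfam i) :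
    ∃ W : Submodule ℂ (Γ → ℂ), FiniteDimensional ℂ W ∧
      ∀ t ∈ T, (fun h => ∫ k, η k * φ (h * t * a k) ∂ν) ∈ W := by
  obtain ⟨F, hF, hηF⟩ := hη
  -- the bilinear smear `(η', i) ↦ ρ_{η'} φᵢ`, linear in `η'`
  have hint : ∀ (i : ι) (η' : C(𝕂, ℂ)) (h : Γ), Integrable (fun k => η' k * φfam i (h * a k)) ν :=
    fun i η' h => integrable_mul_comp_smear ν a ha (hφfam i) η' h
  let L : ι → C(𝕂, ℂ) →ₗ[ℂ] (Γ → ℂ) := fun i =>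
    { toFun := fun η' h => ∫ k, η' k * φfam i (h * a k) ∂ν
      map_add' := fun η₁ η₂ => by
        funext h
        simp only [ContinuousMap.add_apply, add_mul, Pi.add_apply]
        exact integral_add (hint i η₁ h) (hint i η₂ h)
      map_smul' := fun c η₁ => by
        funext h
        simp only [ContinuousMap.smul_apply, smul_eq_mul, mul_assoc, RingHom.id_apply, Pi.smul_apply]
        exact integral_const_mul c _ }
  haveI : FiniteDimensional ℂ F := hF
  refine ⟨⨆ i, F.map (L i), inferInstance, fun t ht => ?_⟩
  obtain ⟨k₀, u, i, rfl, hu, hφu⟩ := hT t ht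
  have hmem : (L i) (leftTranslate k₀ η) ∈ F.map (L i) := Submodule.mem_map_of_mem (hηF k₀)
  have heq : (fun h => ∫ k, η k * φ (h * (a k₀ * u) * a k) ∂ν) = (L i) (leftTranslate k₀ η) := by
    funext h
    change (∫ k, η k * φ (h * (a k₀ * u) * a k) ∂ν) = ∫ k, leftTranslate k₀ η k * φfam i (h * a k) ∂ν
    rw [← smear_apply_mul_eq ν a (φfam i) η h k₀, ← hφu]
    refine integral_congr_ae (Eventually.of_forall fun k => ?_)
    change η k * φ (h * (a k₀ * u) * a k) = η k * φ (h * a k₀ * a k * u)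
    rw [← mul_assoc h, mul_assoc (h * a k₀) u, hu k, ← mul_assoc]
  rw [heq]
  exact Submodule.mem_iSup_of_mem i hmem

/-! ### §5 Uniform approximation -/

omit [IsTopologicalGroup 𝕂] [CompactSpace 𝕂] [T2Space 𝕂] [MeasurableSpace 𝕂] [BorelSpace 𝕂] in
include ha in
/-- **Uniform continuity along `a(𝕂)` on compacts**: for a compact `A ⊆ Γ` and `ε > 0` there is a neighbourhood `V` of `1 ∈ 𝕂` with
`‖φ(h·a(k)) − φ(h)‖ < ε` for all `k ∈ V`, `h ∈ A` (the curried map `𝕂 → C(A, ℂ)` is continuous). [cite: Folland1995, §2.2] -/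
theorem exists_nhds_forall_norm_sub_lt {φ : Γ → ℂ} (hφ : Continuous φ) {A : Set Γ} (hA : IsCompact A) {ε : ℝ} (hε : 0 < ε) :
    ∃ V ∈ 𝓝 (1 : 𝕂), ∀ k ∈ V, ∀ h ∈ A, ‖φ (h * a k) - φ h‖ < ε := by
  haveI : CompactSpace A := isCompact_iff_compactSpace.1 hA
  let F : C(𝕂 × A, ℂ) := ⟨fun q => φ ((q.2 : Γ) * a q.1),
    hφ.comp ((continuous_subtype_val.comp continuous_snd).mul (ha.comp continuous_fst))⟩
  have hc : Continuous fun k : 𝕂 => F.curry k := F.curry.continuous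
  have h1 : ∀ᶠ k in 𝓝 (1 : 𝕂), dist (F.curry k) (F.curry 1) < ε := (hc.tendsto 1) (Metric.ball_mem_nhds _ hε)
  refine ⟨{k | dist (F.curry k) (F.curry 1) < ε}, h1, fun k hk h hh => ?_⟩
  have h2 := (ContinuousMap.dist_apply_le_dist (f := F.curry k) (g := F.curry 1) ⟨h, hh⟩).trans_lt hk
  rw [dist_eq_norm] at h2
  simpa [F] using h2

omit [IsTopologicalGroup Γ] [TopologicalSpace Γ] [IsTopologicalGroup 𝕂] [CompactSpace 𝕂] [T2Space 𝕂] [BorelSpace 𝕂]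
  [IsFiniteMeasureOnCompacts ν] [TopologicalSpace 𝕂] in
/-- **Approximate identities approximate**: for a real weight `η ≥ 0` of mass `1` with `‖φ(h·a(k)) − φ(h)‖ ≤ ε` on the support of `η`,
`‖(ρ_η φ)(h) − φ(h)‖ ≤ ε`. [cite: Folland1995, §2.2] -/
theorem norm_smear_sub_le_of_forall (φ : Γ → ℂ) {η : 𝕂 → ℝ} (hη0 : 0 ≤ η) (hηi : Integrable η ν) (hη1 : ∫ k, η k ∂ν = 1)
    (h : Γ) {ε : ℝ} (hint : Integrable (fun k => (η k : ℂ) * φ (h * a k)) ν)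
    (hε : ∀ k, η k ≠ 0 → ‖φ (h * a k) - φ h‖ ≤ ε) :
    ‖(∫ k, (η k : ℂ) * φ (h * a k) ∂ν) - φ h‖ ≤ ε := by
  have hI : (∫ k, (η k : ℂ) ∂ν) = 1 := by
    have h2 := ContinuousLinearMap.integral_comp_comm Complex.ofRealCLM hηi
    simp only [Complex.ofRealCLM_apply] at h2
    rw [h2, hη1, Complex.ofReal_one]
  have hφh : φ h = ∫ k, (η k : ℂ) * φ h ∂ν := by
    rw [integral_mul_const, hI, one_mul]
  have hint2 : Integrable (fun k => (η k : ℂ) * φ h) ν := (hηi.ofReal (𝕜 := ℂ)).mul_const _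
  rw [hφh, ← integral_sub hint hint2]
  have hb : ∀ k, ‖(η k : ℂ) * φ (h * a k) - (η k : ℂ) * φ h‖ ≤ η k * ε := by
    intro k
    rw [← mul_sub, norm_mul, Complex.norm_real, Real.norm_of_nonneg (hη0 k)]
    by_cases hk : η k = 0
    · rw [hk, zero_mul, zero_mul]
    · exact mul_le_mul_of_nonneg_left (hε k hk) (hη0 k)
  calc ‖∫ k, ((η k : ℂ) * φ (h * a k) - (η k : ℂ) * φ h) ∂ν‖ ≤ ∫ k, η k * ε ∂ν :=
        norm_integral_le_of_norm_le (hηi.mul_const ε) (Eventually.of_forall hb)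
    _ = ε := by rw [integral_mul_const, hη1, one_mul]

omit [IsTopologicalGroup Γ] [TopologicalSpace Γ] [IsTopologicalGroup 𝕂] [T2Space 𝕂] [BorelSpace 𝕂] in
/-- **Stability in the weight**: `‖ρ_η φ(h) − ρ_{η'} φ(h)‖ ≤ δ · ν(𝕂) · M` if `‖η(k) − η'(k)‖ ≤ δ` and `‖φ(h·a(k))‖ ≤ M` for all `k`.
[cite: Folland1995, §3.2] -/
theorem norm_smear_sub_smear_le (φ : Γ → ℂ) {η η' : 𝕂 → ℂ} (h : Γ) {δ M : ℝ}
    (hint : Integrable (fun k => η k * φ (h * a k)) ν) (hint' : Integrable (fun k => η' k * φ (h * a k)) ν)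
    (hδ : ∀ k, ‖η k - η' k‖ ≤ δ) (hφM : ∀ k, ‖φ (h * a k)‖ ≤ M) :
    ‖(∫ k, η k * φ (h * a k) ∂ν) - ∫ k, η' k * φ (h * a k) ∂ν‖ ≤ δ * M * ν.real Set.univ := by
  rw [← integral_sub hint hint']
  refine norm_integral_le_of_norm_le_const (Eventually.of_forall fun k => ?_)
  change ‖η k * φ (h * a k) - η' k * φ (h * a k)‖ ≤ δ * M
  rw [← sub_mul, norm_mul]
  exact mul_le_mul (hδ k) (hφM k) (norm_nonneg _) ((norm_nonneg _).trans (hδ k))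

/-! ### §6 Bumps of mass one and their translation-finite approximations -/

omit [IsTopologicalGroup 𝕂] in
/-- **Bumps of mass `1`**: for an open neighbourhood `V` of `1` in the compact group `𝕂` (measure positive on opens) there is a continuous
`η ≥ 0` with `∫ η dν = 1` vanishing off `V`. [cite: Folland1995, §2.2] -/
theorem exists_continuous_nonneg_integral_eq_one [ν.IsOpenPosMeasure] {V : Set 𝕂} (hV : IsOpen V) (h1 : (1 : 𝕂) ∈ V) :
    ∃ η : C(𝕂, ℝ), (∀ k, 0 ≤ η k) ∧ (∫ k, η k ∂ν = 1) ∧ ∀ k, η k ≠ 0 → k ∈ V := by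
  obtain ⟨η₀, hη₀V, hη₀1, hη₀01⟩ :
      ∃ η₀ : C(𝕂, ℝ), (∀ k ∈ Vᶜ, η₀ k = 0) ∧ η₀ 1 = 1 ∧ ∀ k, η₀ k ∈ Set.Icc (0 : ℝ) 1 := by
    obtain ⟨f, hf0, hf1, hf01⟩ := exists_continuous_zero_one_of_isClosed hV.isClosed_compl isClosed_singleton
      (Set.disjoint_singleton_right.2 (fun h => h h1))
    exact ⟨f, fun k hk => hf0 hk, hf1 rfl, hf01⟩
  have hη₀c : Continuous η₀ := η₀.continuous
  have hη₀i : Integrable (fun k => η₀ k) ν := hη₀c.integrable_of_hasCompactSupport (HasCompactSupport.of_compactSpace _)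
  have hpos : 0 < ∫ k, η₀ k ∂ν := by
    rw [integral_pos_iff_support_of_nonneg (fun k => (hη₀01 k).1) hη₀i]
    have hUo : IsOpen {k : 𝕂 | (0 : ℝ) < η₀ k} := isOpen_lt continuous_const hη₀c
    have hU1 : (1 : 𝕂) ∈ {k : 𝕂 | (0 : ℝ) < η₀ k} := by
      change (0 : ℝ) < η₀ 1; rw [hη₀1]; exact one_pos
    exact (hUo.measure_pos ν ⟨1, hU1⟩).trans_le (measure_mono fun k hk => ne_of_gt hk)
  refine ⟨(∫ k, η₀ k ∂ν)⁻¹ • η₀, fun k => ?_, ?_, fun k hk => ?_⟩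
  · change 0 ≤ (∫ k, η₀ k ∂ν)⁻¹ * η₀ k
    exact mul_nonneg (inv_nonneg.2 hpos.le) (hη₀01 k).1
  · change ∫ k, (∫ k, η₀ k ∂ν)⁻¹ * η₀ k ∂ν = 1
    rw [integral_const_mul, inv_mul_cancel₀ hpos.ne']
  · by_contra hkV
    exact hk (by change (∫ k, η₀ k ∂ν)⁻¹ * η₀ k = 0; rw [hη₀V k hkV, mul_zero])

omit [MeasurableSpace 𝕂] [BorelSpace 𝕂] [IsFiniteMeasureOnCompacts ν] in
/-- **Translation-finite weights approximate every continuous weight uniformly** (★ Peter–Weyl `dense_translationFiniteSubalgebra`):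
for `η₀ : C(𝕂, ℂ)` and `δ > 0` some left-translation-finite `η` has `‖η(k) − η₀(k)‖ < δ` for all `k`. [cite: BrockerTomDieck1985, III Thm (3.1)] -/
theorem exists_isTranslationFinite_forall_norm_sub_lt (η₀ : C(𝕂, ℂ)) {δ : ℝ} (hδ : 0 < δ) :
    ∃ η : C(𝕂, ℂ), IsTranslationFinite η ∧ ∀ k, ‖η k - η₀ k‖ < δ := by
  obtain ⟨η, hηmem, hηd⟩ := (dense_translationFiniteSubalgebra (G := 𝕂)).exists_dist_lt η₀ hδ
  refine ⟨η, (mem_translationFiniteSubalgebra.1 hηmem), fun k => ?_⟩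
  have h := (ContinuousMap.dist_apply_le_dist (f := η) (g := η₀) k).trans_lt (by rwa [dist_comm] at hηd)
  rwa [dist_eq_norm] at h

end Generic

/-! ### §7 The doubled-unitary frame: sections stay sections, `𝒦`-finiteness -/

section Frame

open Literature.NumberTheory.GaloisRepresentations
open Literature.NumberTheory.GelbartRogawski1991 Literature.NumberTheory.GelbartRogawski1991.GRConstruction
open Literature.NumberTheory.K2Lit.SiegelDoubled
open NumberField

variable (L : Type) [Field L] [NumberField L] [IsCMField L]
variable {N M n : ℕ} (e : Fin N × Fin M ≃ Fin n)
  (dV : Fin N → L) (hdV : ∀ i, IsCMField.complexConj L (dV i) = dV i)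
  (dW : Fin M → L) (hdW : ∀ i, IsCMField.complexConj L (dW i) = dW i)
  {𝕂 : Type*} [Group 𝕂] [MeasurableSpace 𝕂] (ν : Measure 𝕂) (a : 𝕂 →* HA L e dV hdV dW hdW)

/-- **The smear of a Siegel section is a Siegel section** (★ `IsSiegelDeltaSection`; the inducing character acts on the left, the smear on the
right). [cite: Liu2011, §2C p. 863] [cite: Folland1995, §3.2] -/
theorem isSiegelDeltaSection_smear (χ : HeckeCharacter L) (s : ℂ) {φ : HA L e dV hdV dW hdW → ℂ}
    (hφ : IsSiegelDeltaSection L e dV hdV dW hdW χ s φ) (η : 𝕂 → ℂ) :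
    IsSiegelDeltaSection L e dV hdV dW hdW χ s fun h => ∫ k, η k * φ (h * a k) ∂ν :=
  fun p hp h => smear_mul_left_of_forall ν a φ η (hφ p hp) h

variable [TopologicalSpace 𝕂] [IsTopologicalGroup 𝕂] [CompactSpace 𝕂] [BorelSpace 𝕂] [IsFiniteMeasureOnCompacts ν]
  [ν.IsMulLeftInvariant]

/-- **`𝒦`-finiteness of the smear.** For an Iwasawa datum `𝒦` every element of whose `K` factors as `a(k₀)·u` with `u` commuting with `a(𝕂)`
and `φ(· u)` in a finite family of continuous functions (in the application: `𝕂 = K_{𝒦,∞}`, `u` the finite part, `φ` smooth of finite type at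
the finite places), the smear of `φ` by a left-translation-finite `η` is ★ `IsKFinite 𝒦`. [cite: BorelJacquet1979, §4.1] [cite: BrockerTomDieck1985, III (5.7)] -/
theorem isKFinite_smear (ha : Continuous a) (𝒦 : IwasawaDatum L e dV hdV dW hdW) (φ : HA L e dV hdV dW hdW → ℂ)
    {η : C(𝕂, ℂ)} (hη : IsTranslationFinite η) {ι : Type*} [Finite ι] (φfam : ι → HA L e dV hdV dW hdW → ℂ)
    (hφfam : ∀ i, Continuous (φfam i))
    (hK : ∀ t ∈ 𝒦.K, ∃ (k₀ : 𝕂) (u : HA L e dV hdV dW hdW) (i : ι),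
      t = a k₀ * u ∧ (∀ k, u * a k = a k * u) ∧ (fun h => φ (h * u)) = φfam i) :
    IsKFinite 𝒦 fun h => ∫ k, η k * φ (h * a k) ∂ν := by
  obtain ⟨W, hW, hmem⟩ := exists_submodule_forall_smear_translate_mem ν a ha φ hη φfam hφfam (𝒦.K : Set (HA L e dV hdV dW hdW)) hK
  haveI := hW
  have hle : rightTranslateSpan 𝒦 (fun h => ∫ k, η k * φ (h * a k) ∂ν) ≤ W := by
    refine Submodule.span_le.2 ?_
    rintro _ ⟨k, rfl⟩
    exact hmem k k.2
  exact Submodule.finiteDimensional_of_le hle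

end Frame

end Summit.HodgeConjecture.HodgeConjecture.Cruxes.HLiu418.K2LiuSectionSmear

end
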